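import Literature.MathematicalPhysics.QuantumLattice.HubbardNNNHoppingEnergyDensityParticleHole
import HarnessLib

/-!
# Concavity of the `t–t'` Hubbard ground-state energy in the couplings `(t, t', U)`

Family `hubbard` (topic `MathematicalPhysics/QuantumLattice`). The `t–t'` Hubbard Hamiltonian
`H(t, t', U) = -t Σ_{⟨xy⟩σ} c†c - t' Σ_{⟨⟨xy⟩⟩σ} c†c + U Σ n↑n↓` (LeBlanc et al. (2015) eq. (1), Xu et
al. (2024) eq. (1); tree `hubbardRectTorusTT' a b t t' U`) is LINEAR in the coupling vector
`(t, t', U)` (`hubbardRectTorusTT'_convexComb`), so every sector ground-state energy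
`E_N(t, t', U) = inf_ψ Re⟨ψ, H(t,t',U)ψ⟩` is an infimum of linear functions of `(t, t', U)`, hence
JOINTLY CONCAVE (`concaveOn_groundEnergy_hubbardRectTorusTT'`; the variational principle, as in the
tree's `DoubleOccupancy.concaveOn_groundEnergyAt` for the `U`-direction at `t' = 0`). Passing to
the thermodynamic limit along the square tori (`tendsto_energyDensityTT'`, Ruelle (1969) §3.3):

* `concaveOn_energyDensityTT'_U` — `U ↦ e(t, t', U, n)` is concave on `[0, ∞)` (every `t, t'`,
  `0 ≤ n < 2`);
* `concaveOn_energyDensityTT'_tPrime` — `t' ↦ e(t, t', U, n)` is concave on `ℝ` (`U ≥ 0`);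
* `energyDensityTT'_chord_le` — the CERTIFIED-CHORD form in `U`: lower bounds `L₁ ≤ e(U₁)`,
  `L₂ ≤ e(U₂)` at `0 ≤ U₁ < U < U₂` give `((U₂ - U) L₁ + (U - U₁) L₂)/(U₂ - U₁) ≤ e(U)` (interpolated
  LOWER bounds at intermediate couplings from certified ones, no new certificate);
* `energyDensityTT'_one_le_tPrime_zero` — at HALF FILLING `e(t, t', U, 1) ≤ e(t, 0, U, 1) =
  energyDensity2D t U 1` for every `t'` (`t' ↦ e` is concave AND even at `n = 1` by the particle–hole
  symmetry `energyDensityTT'_particleHole_one`, hence maximal at `t' = 0`): every certified UPPER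
  bound on the half-filled square-lattice energy density is one for the half-filled `t–t'` model.

Everything is proved; no definitions; no numerical input.

## References

* D. Ruelle, *Statistical Mechanics: Rigorous Results* (1969), §3.3–§3.4 (thermodynamic limit of
  the ground-state energy density; convexity/concavity of thermodynamic functions in the
  parameters of a linear family). [cite: Ruelle1969, §3.3]
* T. Koma, H. Tasaki, J. Stat. Phys. 76 (1994) 745, §1 (ground-state energy concave in a coupling
  constant multiplying a term of the Hamiltonian; supergradients). [cite: KomaTasaki1994, §1]
* J. P. F. LeBlanc et al., Phys. Rev. X 5 (2015) 041041, eq. (1) (the `t–t'–U` family).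
  [cite: LeBlancEtAl2015, eq. (1)]
-/

noncomputable section

open Matrix Finset Filter Topology Set

namespace Literature.MathematicalPhysics.QuantumLattice

namespace ThermodynamicLimit

/-! ### Linearity of the Hamiltonian in `(t, t', U)` and joint concavity in finite volume -/

/-- **The `t–t'` Hamiltonian is linear in the couplings**:
`H(p t₁ + q t₂, p t'₁ + q t'₂, p U₁ + q U₂) = p H(t₁, t'₁, U₁) + q H(t₂, t'₂, U₂)` for all real
`p, q`. [cite: LeBlancEtAl2015, eq. (1)] -/
theorem hubbardRectTorusTT'_convexComb (a b : ℕ) (p q t₁ t₂ t'₁ t'₂ U₁ U₂ : ℝ) :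
    hubbardRectTorusTT' a b (p * t₁ + q * t₂) (p * t'₁ + q * t'₂) (p * U₁ + q * U₂) =
      (p : ℂ) • hubbardRectTorusTT' a b t₁ t'₁ U₁ + (q : ℂ) • hubbardRectTorusTT' a b t₂ t'₂ U₂ := by
  ext i j
  simp only [hubbardRectTorusTT', hamiltonian, Matrix.add_apply, Matrix.smul_apply, smul_eq_mul]
  push_cast
  ring

/-- `Re⟨ψ, (pA + qB)ψ⟩ = p Re⟨ψ, Aψ⟩ + q Re⟨ψ, Bψ⟩` for real `p, q`. [folklore] -/
private theorem re_expect_add_smul {ι : Type*} [Fintype ι] (p q : ℝ)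
    (A B : Matrix (Finset ι) (Finset ι) ℂ) (ψ : Fock ι) :
    (expect ((p : ℂ) • A + (q : ℂ) • B) ψ).re = p * (expect A ψ).re + q * (expect B ψ).re := by
  simp only [expect, add_mulVec, smul_mulVec, dotProduct_add, dotProduct_smul, smul_eq_mul,
    Complex.add_re, Complex.re_ofReal_mul]

/-- **Joint concavity of the sector ground-state energies in `(t, t', U)`.** For every rectangular
torus `ℤ/aℤ × ℤ/bℤ` and every particle number `N`, the map
`(t, t', U) ↦ E_N(t, t', U) = groundEnergy (hubbardRectTorusTT' a b t t' U) N` is concave on `ℝ³`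
(an infimum of the linear functions `(t,t',U) ↦ Re⟨ψ, H(t,t',U)ψ⟩` over unit `N`-particle vectors;
for the empty sector all values are the junk `sInf ∅ = 0`). [cite: KomaTasaki1994, §1] -/
theorem concaveOn_groundEnergy_hubbardRectTorusTT' (a b N : ℕ) :
    ConcaveOn ℝ univ
      (fun v : ℝ × ℝ × ℝ => groundEnergy (hubbardRectTorusTT' a b v.1 v.2.1 v.2.2) N) := by
  refine ⟨convex_univ, fun x _ y _ p q hp hq hpq => ?_⟩
  simp only [smul_eq_mul, Prod.smul_fst, Prod.smul_snd, Prod.fst_add, Prod.snd_add]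
  by_cases hne : ∃ ψ : Fock (Orb (Fin a ×ₗ Fin b)), IsNParticle N ψ ∧ star ψ ⬝ᵥ ψ = 1
  · obtain ⟨ψ₀, hN₀, h₀⟩ := hne
    unfold groundEnergy
    refine le_csInf ⟨_, ψ₀, hN₀, h₀, rfl⟩ ?_
    rintro E ⟨ψ, hN, h1, rfl⟩
    have hx := LiebThm1.groundEnergy_le_re_expect (hubbardRectTorusTT' a b x.1 x.2.1 x.2.2) hN h1
    have hy := LiebThm1.groundEnergy_le_re_expect (hubbardRectTorusTT' a b y.1 y.2.1 y.2.2) hN h1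
    unfold groundEnergy at hx hy
    rw [hubbardRectTorusTT'_convexComb, re_expect_add_smul]
    have h1' := mul_le_mul_of_nonneg_left hx hp
    have h2' := mul_le_mul_of_nonneg_left hy hq
    linarith
  · -- empty sector: all values are the junk value `sInf ∅ = 0`
    have h0 : ∀ t t' U : ℝ, groundEnergy (hubbardRectTorusTT' a b t t' U) N = 0 := by
      intro t t' U
      have hS : {E : ℝ | ∃ ψ : Fock (Orb (Fin a ×ₗ Fin b)), IsNParticle N ψ ∧ star ψ ⬝ᵥ ψ = 1 ∧
          E = (expect (hubbardRectTorusTT' a b t t' U) ψ).re} = ∅ :=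
        Set.eq_empty_iff_forall_notMem.2 (by
          rintro E ⟨ψ, hN, h1, -⟩
          exact hne ⟨ψ, hN, h1⟩)
      show sInf _ = 0
      rw [hS, Real.sInf_empty]
    simp [h0]

/-- **Concavity in `U` in finite volume**: `U ↦ E_N(t, t', U)` is concave on `ℝ` for every torus,
`t, t'`, `N`. [cite: KomaTasaki1994, §1] -/
theorem concaveOn_groundEnergy_hubbardRectTorusTT'_U (a b N : ℕ) (t t' : ℝ) :
    ConcaveOn ℝ univ (fun U : ℝ => groundEnergy (hubbardRectTorusTT' a b t t' U) N) := by
  refine ⟨convex_univ, fun x _ y _ p q hp hq hpq => ?_⟩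
  have h := (concaveOn_groundEnergy_hubbardRectTorusTT' a b N).2 (mem_univ (t, t', x))
    (mem_univ (t, t', y)) hp hq hpq
  simp only [smul_eq_mul, Prod.smul_mk, Prod.mk_add_mk] at h ⊢
  have ht : p * t + q * t = t := by rw [← add_mul, hpq, one_mul]
  have ht' : p * t' + q * t' = t' := by rw [← add_mul, hpq, one_mul]
  rwa [ht, ht'] at h

/-- **Concavity in `t'` in finite volume**: `t' ↦ E_N(t, t', U)` is concave on `ℝ`.
[cite: KomaTasaki1994, §1] -/
theorem concaveOn_groundEnergy_hubbardRectTorusTT'_tPrime (a b N : ℕ) (t U : ℝ) :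
    ConcaveOn ℝ univ (fun t' : ℝ => groundEnergy (hubbardRectTorusTT' a b t t' U) N) := by
  refine ⟨convex_univ, fun x _ y _ p q hp hq hpq => ?_⟩
  have h := (concaveOn_groundEnergy_hubbardRectTorusTT' a b N).2 (mem_univ (t, x, U))
    (mem_univ (t, y, U)) hp hq hpq
  simp only [smul_eq_mul, Prod.smul_mk, Prod.mk_add_mk] at h ⊢
  have ht : p * t + q * t = t := by rw [← add_mul, hpq, one_mul]
  have hU : p * U + q * U = U := by rw [← add_mul, hpq, one_mul]
  rwa [ht, hU] at h

/-! ### Thermodynamic limit -/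

/-- **`U ↦ e(t, t', U, n)` is concave on `[0, ∞)`** (`0 ≤ n < 2`, every `t, t'`): the pointwise
limit of the concave functions `U ↦ E_{L×L}(N_L(n))/L²`. [cite: Ruelle1969, §3.3] -/
theorem concaveOn_energyDensityTT'_U (t t' : ℝ) {n : ℝ} (hn0 : 0 ≤ n) (hn2 : n < 2) :
    ConcaveOn ℝ (Ici 0) (fun U : ℝ => energyDensityTT' t t' U n) := by
  refine ⟨convex_Ici 0, fun x hx y hy p q hp hq hpq => ?_⟩
  simp only [smul_eq_mul]
  have hx0 : 0 ≤ x := hx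
  have hy0 : 0 ≤ y := hy
  have hz0 : 0 ≤ p * x + q * y := by positivity
  have limx := tendsto_energyDensityTT' t t' hx0 hn0 hn2
  have limy := tendsto_energyDensityTT' t t' hy0 hn0 hn2
  have limz := tendsto_energyDensityTT' t t' hz0 hn0 hn2
  refine le_of_tendsto_of_tendsto' ((limx.const_mul p).add (limy.const_mul q)) limz fun L => ?_
  have hL := (concaveOn_groundEnergy_hubbardRectTorusTT'_U L L (rectN n L) t t').2
    (mem_univ x) (mem_univ y) hp hq hpq
  simp only [smul_eq_mul] at hL
  have hL2 : (0 : ℝ) ≤ (L : ℝ) ^ 2 := sq_nonneg _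
  calc p * (groundEnergy (hubbardRectTorusTT' L L t t' x) (rectN n L) / (L : ℝ) ^ 2) +
        q * (groundEnergy (hubbardRectTorusTT' L L t t' y) (rectN n L) / (L : ℝ) ^ 2)
      = (p * groundEnergy (hubbardRectTorusTT' L L t t' x) (rectN n L) +
          q * groundEnergy (hubbardRectTorusTT' L L t t' y) (rectN n L)) / (L : ℝ) ^ 2 := by ring
    _ ≤ groundEnergy (hubbardRectTorusTT' L L t t' (p * x + q * y)) (rectN n L) / (L : ℝ) ^ 2 :=
        div_le_div_of_nonneg_right hL hL2

/-- **`t' ↦ e(t, t', U, n)` is concave on `ℝ`** (`U ≥ 0`, `0 ≤ n < 2`). [cite: Ruelle1969, §3.3] -/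
theorem concaveOn_energyDensityTT'_tPrime (t : ℝ) {U : ℝ} (hU : 0 ≤ U) {n : ℝ} (hn0 : 0 ≤ n)
    (hn2 : n < 2) :
    ConcaveOn ℝ univ (fun t' : ℝ => energyDensityTT' t t' U n) := by
  refine ⟨convex_univ, fun x _ y _ p q hp hq hpq => ?_⟩
  simp only [smul_eq_mul]
  have limx := tendsto_energyDensityTT' t x hU hn0 hn2
  have limy := tendsto_energyDensityTT' t y hU hn0 hn2
  have limz := tendsto_energyDensityTT' t (p * x + q * y) hU hn0 hn2
  refine le_of_tendsto_of_tendsto' ((limx.const_mul p).add (limy.const_mul q)) limz fun L => ?_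
  have hL := (concaveOn_groundEnergy_hubbardRectTorusTT'_tPrime L L (rectN n L) t U).2
    (mem_univ x) (mem_univ y) hp hq hpq
  simp only [smul_eq_mul] at hL
  have hL2 : (0 : ℝ) ≤ (L : ℝ) ^ 2 := sq_nonneg _
  calc p * (groundEnergy (hubbardRectTorusTT' L L t x U) (rectN n L) / (L : ℝ) ^ 2) +
        q * (groundEnergy (hubbardRectTorusTT' L L t y U) (rectN n L) / (L : ℝ) ^ 2)
      = (p * groundEnergy (hubbardRectTorusTT' L L t x U) (rectN n L) +
          q * groundEnergy (hubbardRectTorusTT' L L t y U) (rectN n L)) / (L : ℝ) ^ 2 := by ring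
    _ ≤ groundEnergy (hubbardRectTorusTT' L L t (p * x + q * y) U) (rectN n L) / (L : ℝ) ^ 2 :=
        div_le_div_of_nonneg_right hL hL2

/-! ### Certified-chord corollaries -/

/-- **Interpolated lower bounds in `U`.** For `0 ≤ U₁ < U < U₂`, `0 ≤ n < 2` and certified lower
bounds `L₁ ≤ e(t,t',U₁,n)`, `L₂ ≤ e(t,t',U₂,n)`:
`((U₂ - U) L₁ + (U - U₁) L₂)/(U₂ - U₁) ≤ e(t,t',U,n)` (concavity: `e` lies above its chords).
[cite: Ruelle1969, §3.3] -/
theorem energyDensityTT'_chord_le (t t' : ℝ) {n : ℝ} (hn0 : 0 ≤ n) (hn2 : n < 2)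
    {U₁ U U₂ L₁ L₂ : ℝ} (hU₁ : 0 ≤ U₁) (h₁ : U₁ < U) (h₂ : U < U₂)
    (hL₁ : L₁ ≤ energyDensityTT' t t' U₁ n) (hL₂ : L₂ ≤ energyDensityTT' t t' U₂ n) :
    ((U₂ - U) * L₁ + (U - U₁) * L₂) / (U₂ - U₁) ≤ energyDensityTT' t t' U n := by
  have hd : 0 < U₂ - U₁ := by linarith
  set p : ℝ := (U₂ - U) / (U₂ - U₁) with hp'
  set q : ℝ := (U - U₁) / (U₂ - U₁) with hq'
  have hp : 0 ≤ p := div_nonneg (by linarith) hd.le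
  have hq : 0 ≤ q := div_nonneg (by linarith) hd.le
  have hpq : p + q = 1 := by
    rw [hp', hq', ← add_div, div_eq_one_iff_eq hd.ne']
    ring
  have hc := (concaveOn_energyDensityTT'_U t t' hn0 hn2).2 (show U₁ ∈ Ici (0 : ℝ) from hU₁)
    (show U₂ ∈ Ici (0 : ℝ) from le_trans hU₁ (by linarith)) hp hq hpq
  simp only [smul_eq_mul] at hc
  have hU : p * U₁ + q * U₂ = U := by
    rw [hp', hq']
    field_simp
    ring
  rw [hU] at hc
  have e1 : ((U₂ - U) * L₁ + (U - U₁) * L₂) / (U₂ - U₁) = p * L₁ + q * L₂ := by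
    rw [hp', hq']
    field_simp
  rw [e1]
  have h1 := mul_le_mul_of_nonneg_left hL₁ hp
  have h2 := mul_le_mul_of_nonneg_left hL₂ hq
  linarith

/-- **Extrapolated upper bounds in `U`.** For `0 ≤ U₁ < U₂ < U₃`, a certified UPPER bound
`e(U₂) ≤ R₂` and a certified LOWER bound `L₁ ≤ e(U₁)` give, beyond `U₂`,
`e(U₃) ≤ R₂ + (R₂ - L₁)(U₃ - U₂)/(U₂ - U₁)` (the chord through `U₁, U₂` extended to `U₃` lies above
the concave `e`). [cite: Ruelle1969, §3.3] -/
theorem energyDensityTT'_le_extrapolate (t t' : ℝ) {n : ℝ} (hn0 : 0 ≤ n) (hn2 : n < 2)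
    {U₁ U₂ U₃ L₁ R₂ : ℝ} (hU₁ : 0 ≤ U₁) (h₁ : U₁ < U₂) (h₂ : U₂ < U₃)
    (hL₁ : L₁ ≤ energyDensityTT' t t' U₁ n) (hR₂ : energyDensityTT' t t' U₂ n ≤ R₂) :
    energyDensityTT' t t' U₃ n ≤ R₂ + (R₂ - L₁) * (U₃ - U₂) / (U₂ - U₁) := by
  -- `U₂` is an interior point of `[U₁, U₃]`: `e(U₂) ≥ chord(U₁, U₃)`
  have h := energyDensityTT'_chord_le t t' hn0 hn2 (U₁ := U₁) (U := U₂) (U₂ := U₃) hU₁ h₁ h₂ hL₁ le_rfl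
  have hd : 0 < U₃ - U₁ := by linarith
  have hd' : 0 < U₂ - U₁ := by linarith
  rw [div_le_iff₀ hd] at h
  have hR := mul_le_mul_of_nonneg_right hR₂ hd.le
  have key : energyDensityTT' t t' U₃ n * (U₂ - U₁) ≤ R₂ * (U₂ - U₁) + (R₂ - L₁) * (U₃ - U₂) := by
    nlinarith [h, hR]
  have e : R₂ + (R₂ - L₁) * (U₃ - U₂) / (U₂ - U₁) =
      (R₂ * (U₂ - U₁) + (R₂ - L₁) * (U₃ - U₂)) / (U₂ - U₁) := by
    field_simp
  rw [e, le_div_iff₀ hd']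
  exact key

/-- **At half filling the energy density is maximal at `t' = 0`**: for `U ≥ 0` and every `t'`,
`e(t, t', U, 1) ≤ e(t, 0, U, 1)` (`t' ↦ e(t,t',U,1)` is concave and even by the particle–hole
symmetry `energyDensityTT'_particleHole_one`). [cite: LiebWuPhysicaA2003, §1 eq. (3)] -/
theorem energyDensityTT'_one_le_tPrime_zero (t t' : ℝ) {U : ℝ} (hU : 0 ≤ U) :
    energyDensityTT' t t' U 1 ≤ energyDensityTT' t 0 U 1 := by
  have hc := (concaveOn_energyDensityTT'_tPrime t hU (n := 1) zero_le_one one_lt_two).2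
    (mem_univ t') (mem_univ (-t')) (by norm_num : (0 : ℝ) ≤ 1 / 2) (by norm_num : (0 : ℝ) ≤ 1 / 2)
    (by norm_num : (1 / 2 : ℝ) + 1 / 2 = 1)
  simp only [smul_eq_mul] at hc
  rw [energyDensityTT'_particleHole_one t t' hU,
    show (1 / 2 : ℝ) * t' + 1 / 2 * -t' = 0 by ring] at hc
  linarith

/-- The same with the tree's square-lattice density: `e(t, t', U, 1) ≤ energyDensity2D t U 1`
(`energyDensityTT'_zero`), so every certified UPPER bound on the half-filled square-lattice energy
density holds for the half-filled `t–t'` model at every `t'`. [cite: LiebWuPhysicaA2003, §1 eq. (3)] -/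
theorem energyDensityTT'_one_le_energyDensity2D (t t' : ℝ) {U : ℝ} (hU : 0 ≤ U) :
    energyDensityTT' t t' U 1 ≤ energyDensity2D t U 1 := by
  rw [← energyDensityTT'_zero t U 1]
  exact energyDensityTT'_one_le_tPrime_zero t t' hU

end ThermodynamicLimit

end Literature.MathematicalPhysics.QuantumLattice

end
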